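import Summits.RiemannHypothesis.RiemannHypothesis.Theorems.GroundBartaPolarPerronFrobeniusSourceCriterion
import Mathlib.Analysis.SpecialFunctions.Integrals.Basic
import HarnessLib

/-!
# The L²-ROBUST SOURCE BOUND: the source of an even test near a non-negative profile is bounded below by explicit integrals of the profile
(crux `EvenSectorBarta.EvenOneSignedWindows`, item stmt-RiemannHypothesis-19953; route F8 / hand-off H13 of the rh-explicit HANDOFF track,
`IDEAS-finite-rank.md` PART G7-1 (2); RH-free)

The source criterion `swu_cone_of_source` (`GroundBartaPolarPerronFrobeniusSourceCriterion.lean`) asks, for a real test `f` on `[−a, a]`, that the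
SOURCE of `f⁺` be non-negative wherever `f < 0`:

  `S_f(y) = ∫ f⁺(x) w(|x−y|) dx + Σ_{n ∈ weilPrimeIndex a} Λ(n) n^{-1/2} (f⁺(y+log n) + f⁺(y−log n)) − 2 ∫ f⁺(x) cosh((x−y)/2) dx`.

This file proves the inequality that makes `S_f ≥ 0` CERTIFIABLE from an explicit profile: if `f` is even, continuous, supported in `[−a, a]`,
`f(y) < 0`, and `uN` is continuous and `≥ 0` on `[−a, a]` with `∫_{(−a,a)} (f − uN)² ≤ η²`, then for every cut-off `r > 0`

  `S_f(y) ≥ ∫_{(−a,a), |x−y|>r} uN(x) w(|x−y|) dx − η·(∫_{(−a,a), |x−y|>r} w(|x−y|)² dx)^{1/2} − 2 (pN + η √(a + sinh a)) cosh(y/2)`,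

`pN = ∫_{(−a,a)} uN(x) cosh(x/2) dx` (`source_ge_certMargin_of_sq_close`). The primes are dropped (`≥ 0`), the archimedean attraction is cut off
at distance `r` and transported by Cauchy–Schwarz, and the polar repulsion of an EVEN `f⁺` is `2⟨f⁺, cosh(·/2)⟩ cosh(y/2)` with
`f⁺ ≤ uN + |f − uN|`. This is (a slightly stronger form of — `η` in place of `2η` in the polar term) the bound `S_g ≥ Λ_N(y, r; η)` of handoff-idea-3's
route F8 (`IDEAS-finite-rank.md` G7-1 (2)); every term on the right is an explicit integral of the profile, so the hypothesis `hsrc` of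
`swu_cone_of_source` becomes a finite certificate on `uN`. Nothing here bears on RH; one window's sign has no bearing on RH.

References: E. Bombieri, Rend. Mat. Acc. Lincei (9) 11 (2000), Thm 2 (the archimedean density `w`), §4 (`Bombieri2000Weil`); this track,
HOME/handoff/IDEAS-finite-rank.md PART G7.
-/

noncomputable section

set_option linter.dupNamespace false

open Set MeasureTheory Filter
open scoped Real Topology

namespace Summit.RiemannHypothesis.RiemannHypothesis.Theorems.PolarPerronFrobenius

open Literature.NumberTheory.LFunctions
open scoped ArithmeticFunction.vonMangoldt

/-! ## §1 Two elementary integral facts on the window -/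

/-- Pointwise-on-the-window facts hold a.e. for the restricted measure. [folklore] -/
theorem ae_restrict_Ioo_of_forall {a : ℝ} {P : ℝ → Prop} (h : ∀ x ∈ Ioo (-a) a, P x) :
    ∀ᵐ x ∂(volume.restrict (Ioo (-a) a)), P x :=
  (ae_restrict_iff' measurableSet_Ioo).2 (Eventually.of_forall h)

/-- **Cauchy–Schwarz on the window** for two functions that are non-negative, bounded and a.e.-strongly measurable on `(−a, a)`:
`∫_{(−a,a)} g h ≤ (∫_{(−a,a)} g²)^{1/2} (∫_{(−a,a)} h²)^{1/2}`. [folklore] -/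
theorem setIntegral_mul_le_sqrt_mul_sqrt {a : ℝ} {g h : ℝ → ℝ} (hg0 : ∀ x ∈ Ioo (-a) a, 0 ≤ g x)
    (hh0 : ∀ x ∈ Ioo (-a) a, 0 ≤ h x)
    (hgm : AEStronglyMeasurable g (volume.restrict (Ioo (-a) a)))
    (hhm : AEStronglyMeasurable h (volume.restrict (Ioo (-a) a)))
    {G H : ℝ} (hgb : ∀ x ∈ Ioo (-a) a, g x ≤ G) (hhb : ∀ x ∈ Ioo (-a) a, h x ≤ H) :
    ∫ x in Ioo (-a) a, g x * h x ≤
      Real.sqrt (∫ x in Ioo (-a) a, g x ^ 2) * Real.sqrt (∫ x in Ioo (-a) a, h x ^ 2) := by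
  haveI : IsFiniteMeasure (volume.restrict (Ioo (-a) a)) := by
    refine ⟨?_⟩
    rw [Measure.restrict_apply_univ, Real.volume_Ioo]
    exact ENNReal.ofReal_lt_top
  have hgL : MemLp g (ENNReal.ofReal 2) (volume.restrict (Ioo (-a) a)) :=
    memLp_of_bounded (a := 0) (b := G) (ae_restrict_Ioo_of_forall fun x hx ↦ ⟨hg0 x hx, hgb x hx⟩) hgm _
  have hhL : MemLp h (ENNReal.ofReal 2) (volume.restrict (Ioo (-a) a)) :=
    memLp_of_bounded (a := 0) (b := H) (ae_restrict_Ioo_of_forall fun x hx ↦ ⟨hh0 x hx, hhb x hx⟩) hhm _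
  have hcs := integral_mul_le_Lp_mul_Lq_of_nonneg Real.HolderConjugate.two_two
    (ae_restrict_Ioo_of_forall hg0) (ae_restrict_Ioo_of_forall hh0) hgL hhL
  have e1 : ∀ (k : ℝ → ℝ), (∫ x in Ioo (-a) a, k x ^ (2 : ℝ)) ^ (1 / (2 : ℝ)) =
      Real.sqrt (∫ x in Ioo (-a) a, k x ^ 2) := by
    intro k
    rw [Real.sqrt_eq_rpow]
    congr 1
    refine integral_congr_ae (Eventually.of_forall fun x ↦ ?_)
    exact Real.rpow_two (k x)
  rw [e1 g, e1 h] at hcs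
  exact hcs

/-- `∫_{(−a,a)} cosh(x/2)² dx = a + sinh a` (`a ≥ 0`). [folklore] -/
theorem setIntegral_cosh_half_sq {a : ℝ} (ha : 0 ≤ a) :
    ∫ x in Ioo (-a) a, Real.cosh (x / 2) ^ 2 = a + Real.sinh a := by
  have hid : ∀ x : ℝ, Real.cosh (x / 2) ^ 2 = (Real.cosh x + 1) / 2 := by
    intro x
    have h := Real.cosh_two_mul (x / 2)
    rw [show 2 * (x / 2) = x by ring, Real.sinh_sq] at h
    linarith
  simp_rw [hid]
  rw [← integral_Icc_eq_integral_Ioo, integral_Icc_eq_integral_Ioc, ← intervalIntegral.integral_of_le (by linarith : -a ≤ a),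
    intervalIntegral.integral_div,
    intervalIntegral.integral_add (Real.continuous_cosh.intervalIntegrable _ _) intervalIntegrable_const]
  have hcosh : ∫ x in -a..a, Real.cosh x = Real.sinh a - Real.sinh (-a) :=
    intervalIntegral.integral_eq_sub_of_hasDerivAt (fun x _ ↦ Real.hasDerivAt_sinh x)
      (Real.continuous_cosh.intervalIntegrable _ _)
  rw [hcosh, intervalIntegral.integral_const, Real.sinh_neg]
  simp only [smul_eq_mul, mul_one]
  ring

/-- A function bounded and a.e.-strongly measurable on the window is integrable there. [folklore] -/
theorem integrableOn_Ioo_of_bounded {a : ℝ} {g : ℝ → ℝ} (hgm : AEStronglyMeasurable g (volume.restrict (Ioo (-a) a)))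
    {C : ℝ} (hgb : ∀ x ∈ Ioo (-a) a, |g x| ≤ C) : IntegrableOn g (Ioo (-a) a) := by
  haveI : IsFiniteMeasure (volume.restrict (Ioo (-a) a)) := by
    refine ⟨?_⟩
    rw [Measure.restrict_apply_univ, Real.volume_Ioo]
    exact ENNReal.ofReal_lt_top
  have h := memLp_of_bounded (a := -C) (b := C) (ae_restrict_Ioo_of_forall fun x hx ↦ abs_le.1 (hgb x hx)) hgm 1
  exact memLp_one_iff_integrable.1 h

/-! ## §2 The robust source bound -/

variable {f uN : ℝ → ℝ} {a η r : ℝ}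

/-- A continuous function whose topological support lies in `[−a, a]` vanishes off the OPEN window `(−a, a)`. [folklore] -/
theorem eq_zero_of_notMem_Ioo (hf : Continuous f) (hfs : tsupport f ⊆ Icc (-a) a) {x : ℝ} (hx : x ∉ Ioo (-a) a) :
    f x = 0 := by
  by_contra h
  have hopen : IsOpen (Function.support f) := hf.isOpen_support
  have hsub : Function.support f ⊆ interior (Icc (-a) a) :=
    interior_maximal ((subset_tsupport f).trans hfs) hopen
  rw [interior_Icc] at hsub
  exact hx (hsub (Function.mem_support.2 h))

/-- **THE L²-ROBUST SOURCE BOUND.** Let `f` be continuous, even, with `tsupport f ⊆ [−a, a]` (`a > 0`), let `uN` be continuous and `≥ 0` on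
`[−a, a]` with `∫_{(−a,a)} (f − uN)² ≤ η²` (`η ≥ 0`), and let `f(y) < 0`. Then for every cut-off `r > 0` the source of `f⁺` at `y` (the expression
of `swu_cone_of_source`) is at least
`∫_{(−a,a),|x−y|>r} uN w(|x−y|) − η (∫_{(−a,a),|x−y|>r} w(|x−y|)²)^{1/2} − 2 (∫_{(−a,a)} uN cosh(x/2) + η √(a + sinh a)) cosh(y/2)`.
[this track, IDEAS-finite-rank.md G7-1 (2); cite: Bombieri2000Weil, Thm 2 (the density w)] -/
theorem source_ge_certMargin_of_sq_close (ha : 0 < a) (hη : 0 ≤ η) (hr : 0 < r)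
    (hf : Continuous f) (hfs : tsupport f ⊆ Icc (-a) a) (hfe : ∀ t, f (-t) = f t)
    (huc : ContinuousOn uN (Icc (-a) a)) (hu0 : ∀ x ∈ Icc (-a) a, 0 ≤ uN x)
    (hclose : ∫ x in Ioo (-a) a, (f x - uN x) ^ 2 ≤ η ^ 2) {y : ℝ} (hy : f y < 0) :
    (∫ x in Ioo (-a) a, if r < |x - y| then uN x * weilArchDensity |x - y| else 0)
        - η * Real.sqrt (∫ x in Ioo (-a) a, if r < |x - y| then weilArchDensity |x - y| ^ 2 else 0)
        - 2 * ((∫ x in Ioo (-a) a, uN x * Real.cosh (x / 2)) + η * Real.sqrt (a + Real.sinh a)) * Real.cosh (y / 2) ≤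
      (∫ x, max (f x) 0 * weilArchDensity |x - y|) +
        (∑ n ∈ weilPrimeIndex a, (Λ n : ℝ) / Real.sqrt n *
          (max (f (y + Real.log n)) 0 + max (f (y - Real.log n)) 0)) -
        2 * ∫ x, max (f x) 0 * Real.cosh ((x - y) / 2) := by
  /- ### general facts -/
  have hf0 : ∀ x, x ∉ Ioo (-a) a → f x = 0 := fun x hx ↦ eq_zero_of_notMem_Ioo hf hfs hx
  have hfp0 : ∀ x, x ∉ Ioo (-a) a → max (f x) 0 = 0 := fun x hx ↦ by rw [hf0 x hx, max_self]
  have hfpc : Continuous fun x ↦ max (f x) 0 := hf.max continuous_const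
  have hfcs : HasCompactSupport f := HasCompactSupport.intro isCompact_Icc
    (fun x hx ↦ hf0 x (fun h ↦ hx (Ioo_subset_Icc_self h)))
  have hfpcs : HasCompactSupport fun x ↦ max (f x) 0 := HasCompactSupport.intro isCompact_Icc
    (fun x hx ↦ hfp0 x (fun h ↦ hx (Ioo_subset_Icc_self h)))
  obtain ⟨B, hB⟩ := hfcs.exists_bound_of_continuous hf
  have hB0 : 0 ≤ B := (norm_nonneg _).trans (hB 0)
  have hfB : ∀ x, |f x| ≤ B := fun x ↦ by simpa [Real.norm_eq_abs] using hB x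
  have hfp_nn : ∀ x, 0 ≤ max (f x) 0 := fun x ↦ le_max_right _ _
  have hfpB : ∀ x, max (f x) 0 ≤ B := fun x ↦ max_le ((le_abs_self _).trans (hfB x)) hB0
  obtain ⟨U, hU⟩ := isCompact_Icc.exists_bound_of_continuousOn huc
  have hU' : ∀ x ∈ Ioo (-a) a, |uN x| ≤ U := fun x hx ↦ by simpa [Real.norm_eq_abs] using hU x (Ioo_subset_Icc_self hx)
  have hu0' : ∀ x ∈ Ioo (-a) a, 0 ≤ uN x := fun x hx ↦ hu0 x (Ioo_subset_Icc_self hx)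
  have hfin : volume (Ioo (-a) a) ≠ ⊤ := by rw [Real.volume_Ioo]; exact ENNReal.ofReal_ne_top
  -- measurability
  have hmeas_u : AEStronglyMeasurable uN (volume.restrict (Ioo (-a) a)) :=
    (huc.mono Ioo_subset_Icc_self).aestronglyMeasurable measurableSet_Ioo
  have hker_meas : Measurable fun x : ℝ ↦ weilArchDensity |x - y| :=
    swu_measurable_kernel.comp (measurable_id.sub_const y)
  have hset : MeasurableSet {x : ℝ | r < |x - y|} :=
    measurableSet_lt measurable_const ((measurable_id.sub_const y).abs)
  have hcoshc : Continuous fun x : ℝ ↦ Real.cosh (x / 2) := Real.continuous_cosh.comp (continuous_id.div_const 2)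
  have hsinhc : Continuous fun x : ℝ ↦ Real.sinh (x / 2) := Real.continuous_sinh.comp (continuous_id.div_const 2)
  -- the cut-off kernel `K x = 𝟙_{r<|x−y|} w(|x−y|)`, `0 ≤ K ≤ w(r)`
  set K : ℝ → ℝ := fun x ↦ if r < |x - y| then weilArchDensity |x - y| else 0 with hK_def
  have hKind : K = {x : ℝ | r < |x - y|}.indicator (fun x ↦ weilArchDensity |x - y|) := by
    funext x; simp only [hK_def, Set.indicator_apply, Set.mem_setOf_eq]
  have hKm : Measurable K := by rw [hKind]; exact hker_meas.indicator hset
  have hwr0 : 0 ≤ weilArchDensity r := (weilArchDensity_pos hr).le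
  have hK0 : ∀ x, 0 ≤ K x := fun x ↦ by
    simp only [hK_def]
    split_ifs with h
    · exact (weilArchDensity_pos (hr.trans h)).le
    · exact le_rfl
  have hKb : ∀ x, K x ≤ weilArchDensity r := fun x ↦ by
    simp only [hK_def]
    split_ifs with h
    · exact weilArchDensity_antitoneOn (mem_Ioi.2 hr) (mem_Ioi.2 (hr.trans h)) h.le
    · exact hwr0
  have hK2 : ∀ x, K x ^ 2 = if r < |x - y| then weilArchDensity |x - y| ^ 2 else 0 := fun x ↦ by
    simp only [hK_def]
    split_ifs <;> simp
  /- ### (P1) the prime term is non-negative -/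
  have hP1 : 0 ≤ ∑ n ∈ weilPrimeIndex a, (Λ n : ℝ) / Real.sqrt n *
      (max (f (y + Real.log n)) 0 + max (f (y - Real.log n)) 0) :=
    Finset.sum_nonneg fun n _ ↦ mul_nonneg
      (div_nonneg ArithmeticFunction.vonMangoldt_nonneg (Real.sqrt_nonneg _))
      (add_nonneg (le_max_right _ _) (le_max_right _ _))
  /- ### (P2) the polar term of an even `f⁺` -/
  have hfpe : ∀ x, max (f (-x)) 0 = max (f x) 0 := fun x ↦ by rw [hfe]
  have hint_cosh : Integrable fun x ↦ max (f x) 0 * Real.cosh (x / 2) :=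
    (hfpc.mul hcoshc).integrable_of_hasCompactSupport hfpcs.mul_right
  have hint_sinh : Integrable fun x ↦ max (f x) 0 * Real.sinh (x / 2) :=
    (hfpc.mul hsinhc).integrable_of_hasCompactSupport hfpcs.mul_right
  have hsinh0 : ∫ x, max (f x) 0 * Real.sinh (x / 2) = 0 := by
    have h1 := integral_neg_eq_self (fun x ↦ max (f x) 0 * Real.sinh (x / 2)) volume
    have h2 : (fun x ↦ max (f (-x)) 0 * Real.sinh (-x / 2)) = fun x ↦ -(max (f x) 0 * Real.sinh (x / 2)) := by
      funext x
      rw [hfpe, show -x / 2 = -(x / 2) by ring, Real.sinh_neg]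
      ring
    change (∫ x, max (f (-x)) 0 * Real.sinh (-x / 2)) = ∫ x, max (f x) 0 * Real.sinh (x / 2) at h1
    rw [h2, integral_neg] at h1
    linarith
  have hpolar : ∫ x, max (f x) 0 * Real.cosh ((x - y) / 2) =
      Real.cosh (y / 2) * ∫ x, max (f x) 0 * Real.cosh (x / 2) := by
    have e : (fun x ↦ max (f x) 0 * Real.cosh ((x - y) / 2)) =
        fun x ↦ Real.cosh (y / 2) * (max (f x) 0 * Real.cosh (x / 2)) -
          Real.sinh (y / 2) * (max (f x) 0 * Real.sinh (x / 2)) := by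
      funext x
      rw [show (x - y) / 2 = x / 2 - y / 2 by ring, Real.cosh_sub]
      ring
    rw [e, integral_sub (hint_cosh.const_mul _) (hint_sinh.const_mul _), integral_const_mul, integral_const_mul,
      hsinh0, mul_zero, sub_zero]
  -- `∫ f⁺ cosh(x/2) ≤ pN + η √(a + sinh a)`
  have hcoshb : ∀ x ∈ Ioo (-a) a, Real.cosh (x / 2) ≤ Real.cosh (a / 2) := by
    intro x hx
    rw [← Real.cosh_abs (x / 2), ← Real.cosh_abs (a / 2)]
    refine Real.cosh_le_cosh.2 ?_
    rw [abs_abs, abs_abs, abs_div, abs_div, abs_two]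
    exact div_le_div_of_nonneg_right ((abs_lt.2 ⟨hx.1, hx.2⟩).le.trans (le_abs_self a)) (by norm_num)
  have hCS1 : ∫ x in Ioo (-a) a, |f x - uN x| * Real.cosh (x / 2) ≤ η * Real.sqrt (a + Real.sinh a) := by
    have h1 := setIntegral_mul_le_sqrt_mul_sqrt (a := a) (g := fun x ↦ |f x - uN x|) (h := fun x ↦ Real.cosh (x / 2))
      (fun x _ ↦ abs_nonneg _) (fun x _ ↦ (Real.cosh_pos _).le)
      (((hf.aestronglyMeasurable (μ := volume.restrict (Ioo (-a) a))).sub hmeas_u).norm.congr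
        (Eventually.of_forall fun x ↦ by simp only [Pi.sub_apply, Real.norm_eq_abs]))
      hcoshc.aestronglyMeasurable (G := B + U) (H := Real.cosh (a / 2))
      (fun x hx ↦ (abs_sub _ _).trans (add_le_add (hfB x) (hU' x hx))) hcoshb
    have e2 : ∫ x in Ioo (-a) a, Real.cosh (x / 2) ^ 2 = a + Real.sinh a := setIntegral_cosh_half_sq ha.le
    have e3 : ∫ x in Ioo (-a) a, |f x - uN x| ^ 2 = ∫ x in Ioo (-a) a, (f x - uN x) ^ 2 :=
      integral_congr_ae (Eventually.of_forall fun x ↦ sq_abs _)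
    rw [e2, e3] at h1
    refine h1.trans (mul_le_mul_of_nonneg_right ?_ (Real.sqrt_nonneg _))
    calc Real.sqrt (∫ x in Ioo (-a) a, (f x - uN x) ^ 2) ≤ Real.sqrt (η ^ 2) := Real.sqrt_le_sqrt hclose
      _ = η := Real.sqrt_sq hη
  have hP2 : ∫ x, max (f x) 0 * Real.cosh (x / 2) ≤
      (∫ x in Ioo (-a) a, uN x * Real.cosh (x / 2)) + η * Real.sqrt (a + Real.sinh a) := by
    -- restrict to the window
    have hwin : ∫ x, max (f x) 0 * Real.cosh (x / 2) = ∫ x in Ioo (-a) a, max (f x) 0 * Real.cosh (x / 2) :=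
      (setIntegral_eq_integral_of_forall_compl_eq_zero fun x hx ↦ by rw [hfp0 x hx, zero_mul]).symm
    rw [hwin]
    -- pointwise `f⁺ cosh ≤ (uN + |f − uN|) cosh` on the window
    have hpt : ∀ x ∈ Ioo (-a) a, max (f x) 0 * Real.cosh (x / 2) ≤
        uN x * Real.cosh (x / 2) + |f x - uN x| * Real.cosh (x / 2) := by
      intro x hx
      have hc : 0 ≤ Real.cosh (x / 2) := (Real.cosh_pos _).le
      have : max (f x) 0 ≤ uN x + |f x - uN x| := by
        refine max_le ?_ (add_nonneg (hu0' x hx) (abs_nonneg _))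
        linarith [le_abs_self (f x - uN x)]
      nlinarith
    have hi1 : IntegrableOn (fun x ↦ max (f x) 0 * Real.cosh (x / 2)) (Ioo (-a) a) := hint_cosh.integrableOn
    have hi2 : IntegrableOn (fun x ↦ uN x * Real.cosh (x / 2)) (Ioo (-a) a) := by
      have hm : AEStronglyMeasurable (fun x ↦ uN x * Real.cosh (x / 2)) (volume.restrict (Ioo (-a) a)) :=
        (hmeas_u.mul hcoshc.aestronglyMeasurable).congr (Eventually.of_forall fun x ↦ rfl)
      refine integrableOn_Ioo_of_bounded hm (C := U * Real.cosh (a / 2)) fun x hx ↦ ?_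
      rw [abs_mul, abs_of_pos (Real.cosh_pos _)]
      exact mul_le_mul (hU' x hx) (hcoshb x hx) (Real.cosh_pos _).le ((abs_nonneg _).trans (hU' x hx))
    have hi3 : IntegrableOn (fun x ↦ |f x - uN x| * Real.cosh (x / 2)) (Ioo (-a) a) := by
      have hm : AEStronglyMeasurable (fun x ↦ |f x - uN x| * Real.cosh (x / 2)) (volume.restrict (Ioo (-a) a)) :=
        ((hf.aestronglyMeasurable.sub hmeas_u).norm.mul hcoshc.aestronglyMeasurable).congr
          (Eventually.of_forall fun x ↦ by simp only [Pi.mul_apply, Pi.sub_apply, Real.norm_eq_abs])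
      refine integrableOn_Ioo_of_bounded hm (C := (B + U) * Real.cosh (a / 2)) fun x hx ↦ ?_
      rw [abs_mul, abs_abs, abs_of_pos (Real.cosh_pos _)]
      exact mul_le_mul ((abs_sub _ _).trans (add_le_add (hfB x) (hU' x hx))) (hcoshb x hx)
        (Real.cosh_pos _).le (by linarith [hB0, (abs_nonneg _).trans (hU' x hx)])
    calc ∫ x in Ioo (-a) a, max (f x) 0 * Real.cosh (x / 2)
        ≤ ∫ x in Ioo (-a) a, (uN x * Real.cosh (x / 2) + |f x - uN x| * Real.cosh (x / 2)) :=
          setIntegral_mono_on hi1 (hi2.add hi3) measurableSet_Ioo hpt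
      _ = (∫ x in Ioo (-a) a, uN x * Real.cosh (x / 2)) + ∫ x in Ioo (-a) a, |f x - uN x| * Real.cosh (x / 2) :=
          integral_add hi2 hi3
      _ ≤ _ := by linarith [hCS1]
  /- ### (P3) the archimedean attraction -/
  obtain ⟨ρ, hρ, hρf⟩ : ∃ ρ > 0, ∀ x, dist x y < ρ → f x < 0 :=
    Metric.eventually_nhds_iff.1 (hf.continuousAt (Iio_mem_nhds hy))
  set F : ℝ → ℝ := fun x ↦ max (f x) 0 * weilArchDensity |x - y| with hF_def
  have hFz : ∀ x, dist x y < ρ → F x = 0 := fun x hx ↦ by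
    simp only [hF_def, max_eq_right (hρf x hx).le, zero_mul]
  have hdist : ∀ x, ¬ dist x y < ρ → ρ ≤ |x - y| := fun x hx ↦ by rw [← Real.dist_eq]; exact not_lt.1 hx
  have hF0 : ∀ x, 0 ≤ F x := by
    intro x
    by_cases hx : dist x y < ρ
    · rw [hFz x hx]
    · exact mul_nonneg (hfp_nn x) (weilArchDensity_pos (hρ.trans_le (hdist x hx))).le
  have hFb : ∀ x, F x ≤ B * weilArchDensity ρ := by
    intro x
    by_cases hx : dist x y < ρ
    · rw [hFz x hx]; exact mul_nonneg hB0 (weilArchDensity_pos hρ).le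
    · have hxy := hdist x hx
      have hw : weilArchDensity |x - y| ≤ weilArchDensity ρ :=
        weilArchDensity_antitoneOn (mem_Ioi.2 hρ) (mem_Ioi.2 (hρ.trans_le hxy)) hxy
      exact mul_le_mul (hfpB x) hw (weilArchDensity_pos (hρ.trans_le hxy)).le hB0
  have hFm : Measurable F := hfpc.measurable.mul hker_meas
  have hFwin0 : ∀ x, x ∉ Ioo (-a) a → F x = 0 := fun x hx ↦ by simp only [hF_def, hfp0 x hx, zero_mul]
  have hFon : IntegrableOn F (Ioo (-a) a) :=
    integrableOn_Ioo_of_bounded hFm.aestronglyMeasurable (C := B * weilArchDensity ρ)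
      (fun x _ ↦ by rw [abs_of_nonneg (hF0 x)]; exact hFb x)
  have hFwin : ∫ x, F x = ∫ x in Ioo (-a) a, F x :=
    (setIntegral_eq_integral_of_forall_compl_eq_zero fun x hx ↦ hFwin0 x hx).symm
  -- the cut-off comparison `G ≤ F`, `G = 𝟙_{r<|x−y|} f w = Gu + Gd`
  set Gu : ℝ → ℝ := fun x ↦ if r < |x - y| then uN x * weilArchDensity |x - y| else 0 with hGu_def
  set Gd : ℝ → ℝ := fun x ↦ if r < |x - y| then (f x - uN x) * weilArchDensity |x - y| else 0 with hGd_def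
  have hGuK : ∀ x, Gu x = uN x * K x := fun x ↦ by
    simp only [hGu_def, hK_def]
    split_ifs <;> simp
  have hGdK : ∀ x, Gd x = (f x - uN x) * K x := fun x ↦ by
    simp only [hGd_def, hK_def]
    split_ifs <;> simp
  have hsum : ∀ x, Gu x + Gd x ≤ F x := by
    intro x
    rw [hGuK, hGdK]
    have e : uN x * K x + (f x - uN x) * K x = f x * K x := by ring
    rw [e]
    simp only [hK_def, hF_def]
    split_ifs with h
    · exact mul_le_mul_of_nonneg_right (le_max_left _ _) (weilArchDensity_pos (hr.trans h)).le
    · rw [mul_zero]; exact hF0 x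
  -- integrability of the pieces on the window
  have hGu_m : AEStronglyMeasurable Gu (volume.restrict (Ioo (-a) a)) :=
    (hmeas_u.mul hKm.aestronglyMeasurable).congr (Eventually.of_forall fun x ↦ (hGuK x).symm)
  have hGd_m : AEStronglyMeasurable Gd (volume.restrict (Ioo (-a) a)) :=
    (((hf.aestronglyMeasurable (μ := volume.restrict (Ioo (-a) a))).sub hmeas_u).mul hKm.aestronglyMeasurable).congr
      (Eventually.of_forall fun x ↦ by rw [hGdK x]; rfl)
  have habs_m : AEStronglyMeasurable (fun x ↦ |f x - uN x| * K x) (volume.restrict (Ioo (-a) a)) :=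
    (((hf.aestronglyMeasurable (μ := volume.restrict (Ioo (-a) a))).sub hmeas_u).norm.mul hKm.aestronglyMeasurable).congr
      (Eventually.of_forall fun x ↦ by simp only [Pi.mul_apply, Pi.sub_apply, Real.norm_eq_abs])
  have hdiffB : ∀ x ∈ Ioo (-a) a, |f x - uN x| ≤ B + U := fun x hx ↦
    (abs_sub _ _).trans (add_le_add (hfB x) (hU' x hx))
  have hGu_i : IntegrableOn Gu (Ioo (-a) a) :=
    integrableOn_Ioo_of_bounded hGu_m (C := U * weilArchDensity r) fun x hx ↦ by
      rw [hGuK, abs_mul, abs_of_nonneg (hK0 x)]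
      exact mul_le_mul (hU' x hx) (hKb x) (hK0 x) ((abs_nonneg _).trans (hU' x hx))
  have hGd_i : IntegrableOn Gd (Ioo (-a) a) :=
    integrableOn_Ioo_of_bounded hGd_m (C := (B + U) * weilArchDensity r) fun x hx ↦ by
      rw [hGdK, abs_mul, abs_of_nonneg (hK0 x)]
      exact mul_le_mul (hdiffB x hx) (hKb x) (hK0 x) (by linarith [hB0, (abs_nonneg _).trans (hU' x hx)])
  have habs_i : IntegrableOn (fun x ↦ |f x - uN x| * K x) (Ioo (-a) a) :=
    integrableOn_Ioo_of_bounded habs_m (C := (B + U) * weilArchDensity r) fun x hx ↦ by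
      rw [abs_mul, abs_abs, abs_of_nonneg (hK0 x)]
      exact mul_le_mul (hdiffB x hx) (hKb x) (hK0 x) (by linarith [hB0, (abs_nonneg _).trans (hU' x hx)])
  -- `∫_{Ioo} Gu + ∫_{Ioo} Gd ≤ ∫_{Ioo} F`
  have hstep1 : (∫ x in Ioo (-a) a, Gu x) + ∫ x in Ioo (-a) a, Gd x ≤ ∫ x in Ioo (-a) a, F x := by
    rw [← integral_add hGu_i hGd_i]
    exact setIntegral_mono_on (hGu_i.add hGd_i) hFon measurableSet_Ioo (fun x _ ↦ hsum x)
  -- `∫_{Ioo} Gd ≥ −η √(∫ K²)`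
  have hGd_ge : -(∫ x in Ioo (-a) a, |f x - uN x| * K x) ≤ ∫ x in Ioo (-a) a, Gd x := by
    rw [← integral_neg]
    refine setIntegral_mono_on habs_i.neg hGd_i measurableSet_Ioo (fun x _ ↦ ?_)
    rw [hGdK]
    nlinarith [neg_abs_le (f x - uN x), hK0 x]
  have hCS2 : ∫ x in Ioo (-a) a, |f x - uN x| * K x ≤ η * Real.sqrt (∫ x in Ioo (-a) a, K x ^ 2) := by
    have h1 := setIntegral_mul_le_sqrt_mul_sqrt (a := a) (g := fun x ↦ |f x - uN x|) (h := K)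
      (fun x _ ↦ abs_nonneg _) (fun x _ ↦ hK0 x)
      (((hf.aestronglyMeasurable (μ := volume.restrict (Ioo (-a) a))).sub hmeas_u).norm.congr
        (Eventually.of_forall fun x ↦ by simp only [Pi.sub_apply, Real.norm_eq_abs]))
      hKm.aestronglyMeasurable (G := B + U) (H := weilArchDensity r) hdiffB (fun x _ ↦ hKb x)
    have e3 : ∫ x in Ioo (-a) a, |f x - uN x| ^ 2 = ∫ x in Ioo (-a) a, (f x - uN x) ^ 2 :=
      integral_congr_ae (Eventually.of_forall fun x ↦ sq_abs _)
    rw [e3] at h1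
    refine h1.trans (mul_le_mul_of_nonneg_right ?_ (Real.sqrt_nonneg _))
    calc Real.sqrt (∫ x in Ioo (-a) a, (f x - uN x) ^ 2) ≤ Real.sqrt (η ^ 2) := Real.sqrt_le_sqrt hclose
      _ = η := Real.sqrt_sq hη
  have hK2int : ∫ x in Ioo (-a) a, K x ^ 2 = ∫ x in Ioo (-a) a, (if r < |x - y| then weilArchDensity |x - y| ^ 2 else 0) :=
    integral_congr_ae (Eventually.of_forall hK2)
  /- ### assembly -/
  rw [← hK2int, hpolar]
  have hpol2 := mul_le_mul_of_nonneg_left hP2 (by positivity : (0 : ℝ) ≤ 2 * Real.cosh (y / 2))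
  have hF_eq : (∫ x, max (f x) 0 * weilArchDensity |x - y|) = ∫ x in Ioo (-a) a, F x := hFwin
  rw [hF_eq]
  nlinarith [hstep1, hGd_ge, hCS2, hpol2, hP1, Real.cosh_pos (y / 2)]

end Summit.RiemannHypothesis.RiemannHypothesis.Theorems.PolarPerronFrobenius
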